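import Summits.HubbardSuperconductivity.HubbardSuperconductivity.Theorems.AnisotropyChordTransferFibre3GradSNormClosed

/-!
# Route `AnisotropyChord` / H0 rotor rung: the ground two-magnon profile — VARIATIONAL TOOLKIT (for the `IsGroundTwoMagnon` witness)

The GM₃ assembly (`gm3_of_cruxes_*`, `…Fibre3KTAssembly*`, PORT PartN31) takes a ground two-magnon profile
`hf : IsGroundTwoMagnon L Δ lam2 f` as input («the IsGroundTwoMagnon witness per (L,Δ)», memo KTASSEMBLY-LEAN-g22 §3),
and the KT-2b / one-loop layers use its lattice symmetries (`f(y,x) = f(x,y)`, `f(−x,y) = f(x,y)`).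
This file is the variational toolkit for its construction (the witness itself is `exists_isGroundTwoMagnon` in
`…Fibre3GroundExists`); finite-dimensional variational calculus, all elementary:
* the two-magnon form `Q` (`twoMagnonQF`) attains its minimum `λ` on the compact sphere `{g(0) = 0, Σg² = 1}`
  (`exists_min_sphere`), whence `λΣg² ≤ Q(g)` on `{g(0)=0}` by homogeneity (`qf_smul`);
* a constrained minimiser satisfies the Euler–Lagrange equations `A g = λ g` off the origin (`EL_of_min`, one-site
  variations + `eq_zero_of_forall_quad_nonneg`), and conversely every EL solution attains (`qf_of_EL`): the minimisers
  form a linear space closed under the lattice symmetries `r ↦ −r`, `(x,y) ↦ (y,x)`, `(x,y) ↦ (−x,y)`;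
* a nonnegative minimiser is positive off the origin (zeros propagate: `nbSum_eq_zero_of_min`, `torus_connect`).
Prover seat `hubbard-h0-rotor-p1` g23; helper for stmt-HubbardSuperconductivity-19089 (`--supports`).
-/

set_option linter.dupNamespace false
set_option autoImplicit false

noncomputable section

open scoped BigOperators

namespace Summit.HubbardSuperconductivity.HubbardSuperconductivity.Theorems.AnisotropyChord.Transfer.Fibre3

variable (L : ℕ) [NeZero L]

/-! ## The linear operator of the form and the Euler–Lagrange condition -/

/-- `(A g)(r) = (4 − Δ·1_NN(r)) g(r) − Σ_e g(r+e)`. [folklore] -/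
def tmOp (Δ : ℝ) (g : Tor L → ℝ) (r : Tor L) : ℝ := (4 - Δ * nnInd L r) * g r - nbSum L g r

/-- `Q(g) = Σ_r g(r)·(A g)(r)`. [folklore] -/
theorem qf_eq_sum_tmOp (Δ : ℝ) (g : Tor L → ℝ) : twoMagnonQF L Δ g = ∑ r : Tor L, g r * tmOp L Δ g r := by
  rw [twoMagnonQF_eq]
  refine Finset.sum_congr rfl fun r _ => ?_
  unfold tmOp; ring

/-- a solution of the Euler–Lagrange equations `A g = λ g` off the origin (with `g(0) = 0`) attains: `Q(g) = λ Σ g²`.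
[folklore] -/
theorem qf_of_EL {Δ lam : ℝ} {g : Tor L → ℝ} (h0 : g 0 = 0) (h : ∀ r : Tor L, r ≠ 0 → tmOp L Δ g r = lam * g r) :
    twoMagnonQF L Δ g = lam * ∑ r : Tor L, g r ^ 2 := by
  rw [qf_eq_sum_tmOp, Finset.mul_sum]
  refine Finset.sum_congr rfl fun r _ => ?_
  by_cases hr : r = 0
  · rw [hr, h0]; ring
  · rw [h r hr]; ring

/-- **a constrained minimiser satisfies the Euler–Lagrange equations** (one-site variations). [folklore] -/
theorem EL_of_min {Δ lam : ℝ} {g : Tor L → ℝ}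
    (hmin : ∀ h : Tor L → ℝ, h 0 = 0 → lam * ∑ r : Tor L, h r ^ 2 ≤ twoMagnonQF L Δ h)
    (hg0 : g 0 = 0) (hgQ : twoMagnonQF L Δ g = lam * ∑ r : Tor L, g r ^ 2) :
    ∀ r : Tor L, r ≠ 0 → tmOp L Δ g r = lam * g r := by
  classical
  intro r₁ hr₁
  set δ : Tor L → ℝ := fun r => if r = r₁ then 1 else 0 with hδ
  have hvar : ∀ t : ℝ, 0 ≤ (2 * (tmOp L Δ g r₁ - lam * g r₁)) * t + (twoMagnonQF L Δ δ - lam) * t ^ 2 := by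
    intro t
    have hmin_t := hmin (fun r => g r + t * δ r) (by simp [hδ, hg0, hr₁.symm])
    have hQ := qf_add L Δ g (fun r => t * δ r)
    have hcross : ∑ r : Tor L, (t * δ r) * ((4 - Δ * nnInd L r) * g r - nbSum L g r) = t * tmOp L Δ g r₁ := by
      have : ∀ r : Tor L, (t * δ r) * ((4 - Δ * nnInd L r) * g r - nbSum L g r)
          = if r = r₁ then t * tmOp L Δ g r else 0 := by
        intro r; simp only [hδ, tmOp]; split_ifs <;> ring
      rw [Finset.sum_congr rfl fun r _ => this r, Finset.sum_ite_eq' Finset.univ r₁]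
      simp
    have hsq : ∑ r : Tor L, (g r + t * δ r) ^ 2 = ∑ r : Tor L, g r ^ 2 + 2 * t * g r₁ + t ^ 2 := by
      have : ∀ r : Tor L, (g r + t * δ r) ^ 2 = g r ^ 2 + (if r = r₁ then 2 * t * g r + t ^ 2 else 0) := by
        intro r; simp only [hδ]; split_ifs <;> ring
      rw [Finset.sum_congr rfl fun r _ => this r, Finset.sum_add_distrib, Finset.sum_ite_eq' Finset.univ r₁]
      simp only [Finset.mem_univ, if_true]
      ring
    rw [hQ, hcross, qf_smul, hgQ] at hmin_t
    rw [hsq] at hmin_t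
    nlinarith [hmin_t]
  have := Literature.MathematicalPhysics.QuantumLattice.RayleighBottom.eq_zero_of_forall_quad_nonneg hvar
  linarith

omit [NeZero L] in
/-- EL solutions form a linear space: sums. [folklore] -/
theorem EL_add {Δ lam : ℝ} {g h : Tor L → ℝ} (hg : ∀ r : Tor L, r ≠ 0 → tmOp L Δ g r = lam * g r)
    (hh : ∀ r : Tor L, r ≠ 0 → tmOp L Δ h r = lam * h r) :
    ∀ r : Tor L, r ≠ 0 → tmOp L Δ (fun r => g r + h r) r = lam * (g r + h r) := by
  intro r hr
  have e : tmOp L Δ (fun r => g r + h r) r = tmOp L Δ g r + tmOp L Δ h r := by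
    unfold tmOp; rw [nbSum_add]; ring
  rw [e, hg r hr, hh r hr]; ring

omit [NeZero L] in
/-- EL solutions form a linear space: scalar multiples. [folklore] -/
theorem EL_smul {Δ lam : ℝ} {g : Tor L → ℝ} (hg : ∀ r : Tor L, r ≠ 0 → tmOp L Δ g r = lam * g r) (t : ℝ) :
    ∀ r : Tor L, r ≠ 0 → tmOp L Δ (fun r => t * g r) r = lam * (t * g r) := by
  intro r hr
  have e : tmOp L Δ (fun r => t * g r) r = t * tmOp L Δ g r := by
    unfold tmOp; rw [nbSum_smul]; ring
  rw [e, hg r hr]; ring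

/-! ## The three lattice involutions preserve the EL condition -/

omit [NeZero L] in
/-- `IsNN` is invariant under `(x,y) ↦ (−x,y)`. [folklore] -/
theorem isNN_mirror (r : Tor L) : IsNN L (-r.1, r.2) = IsNN L r := by
  have key : ∀ s : Tor L, IsNN L s = true → IsNN L (-s.1, s.2) = true := by
    intro s hs
    rcases eq_of_isNN L hs with h | h | h | h <;> rw [h]
    · have : ((-(ex L).1, (ex L).2) : Tor L) = -ex L := by unfold ex; simp
      rw [this, IsNN_neg]; exact isNN_ex L
    · have : ((-(-ex L).1, (-ex L).2) : Tor L) = ex L := by unfold ex; simp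
      rw [this]; exact isNN_ex L
    · have : ((-(ey L).1, (ey L).2) : Tor L) = ey L := by unfold ey; simp
      rw [this]; exact isNN_ey L
    · have : ((-(-ey L).1, (-ey L).2) : Tor L) = -ey L := by unfold ey; simp
      rw [this, IsNN_neg]; exact isNN_ey L
  rw [Bool.eq_iff_iff]
  constructor
  · intro h
    have := key (-r.1, r.2) h
    simpa using this
  · exact key r

omit [NeZero L] in
/-- `A` commutes with `r ↦ −r`. [folklore] -/
theorem tmOp_comp_neg (Δ : ℝ) (g : Tor L → ℝ) (r : Tor L) :
    tmOp L Δ (fun s => g (-s)) r = tmOp L Δ g (-r) := by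
  unfold tmOp nnInd nbSum
  rw [IsNN_neg]
  simp only [neg_add, neg_neg]
  ring

omit [NeZero L] in
/-- `A` commutes with `(x,y) ↦ (y,x)`. [folklore] -/
theorem tmOp_comp_swap (Δ : ℝ) (g : Tor L → ℝ) (r : Tor L) :
    tmOp L Δ (fun s => g (s.2, s.1)) r = tmOp L Δ g (r.2, r.1) := by
  unfold tmOp nnInd nbSum
  beta_reduce
  rw [IsNN_swap]
  have e1 : ((r + ex L).2, (r + ex L).1) = (r.2, r.1) + ey L := by unfold ex ey; ext <;> simp
  have e2 : ((r + -ex L).2, (r + -ex L).1) = (r.2, r.1) + -ey L := by unfold ex ey; ext <;> simp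
  have e3 : ((r + ey L).2, (r + ey L).1) = (r.2, r.1) + ex L := by unfold ex ey; ext <;> simp
  have e4 : ((r + -ey L).2, (r + -ey L).1) = (r.2, r.1) + -ex L := by unfold ex ey; ext <;> simp
  rw [e1, e2, e3, e4]
  ring

omit [NeZero L] in
/-- `A` commutes with `(x,y) ↦ (−x,y)`. [folklore] -/
theorem tmOp_comp_mirror (Δ : ℝ) (g : Tor L → ℝ) (r : Tor L) :
    tmOp L Δ (fun s => g (-s.1, s.2)) r = tmOp L Δ g (-r.1, r.2) := by
  unfold tmOp nnInd nbSum
  beta_reduce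
  rw [isNN_mirror]
  have e1 : ((-(r + ex L).1, (r + ex L).2) : Tor L) = (-r.1, r.2) + -ex L := by
    unfold ex; ext <;> simp [add_comm]
  have e2 : ((-(r + -ex L).1, (r + -ex L).2) : Tor L) = (-r.1, r.2) + ex L := by
    unfold ex; ext <;> simp [add_comm]
  have e3 : ((-(r + ey L).1, (r + ey L).2) : Tor L) = (-r.1, r.2) + ey L := by unfold ey; ext <;> simp
  have e4 : ((-(r + -ey L).1, (r + -ey L).2) : Tor L) = (-r.1, r.2) + -ey L := by unfold ey; ext <;> simp
  rw [e1, e2, e3, e4]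
  ring

omit [NeZero L] in
/-- `(y,x) ≠ 0` for `(x,y) ≠ 0`. [folklore] -/
theorem swap_ne_zero {r : Tor L} (hr : r ≠ 0) : ((r.2, r.1) : Tor L) ≠ 0 := by
  intro h; apply hr
  have h1 := congrArg Prod.fst h; have h2 := congrArg Prod.snd h
  simp only [Prod.fst_zero, Prod.snd_zero] at h1 h2
  exact Prod.ext h2 h1

omit [NeZero L] in
/-- `(−x,y) ≠ 0` for `(x,y) ≠ 0`. [folklore] -/
theorem mirror_ne_zero' {r : Tor L} (hr : r ≠ 0) : ((-r.1, r.2) : Tor L) ≠ 0 := by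
  intro h; apply hr
  have h1 := congrArg Prod.fst h; have h2 := congrArg Prod.snd h
  simp only [Prod.fst_zero, Prod.snd_zero, neg_eq_zero] at h1 h2
  exact Prod.ext h1 h2

omit [NeZero L] in
/-- EL is preserved by `r ↦ −r`. [folklore] -/
theorem EL_comp_neg {Δ lam : ℝ} {g : Tor L → ℝ} (hg : ∀ r : Tor L, r ≠ 0 → tmOp L Δ g r = lam * g r) :
    ∀ r : Tor L, r ≠ 0 → tmOp L Δ (fun s => g (-s)) r = lam * g (-r) := by
  intro r hr
  rw [tmOp_comp_neg, hg (-r) (neg_ne_zero.mpr hr)]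

omit [NeZero L] in
/-- EL is preserved by `(x,y) ↦ (y,x)`. [folklore] -/
theorem EL_comp_swap {Δ lam : ℝ} {g : Tor L → ℝ} (hg : ∀ r : Tor L, r ≠ 0 → tmOp L Δ g r = lam * g r) :
    ∀ r : Tor L, r ≠ 0 → tmOp L Δ (fun s => g (s.2, s.1)) r = lam * g (r.2, r.1) := by
  intro r hr
  rw [tmOp_comp_swap, hg _ (swap_ne_zero L hr)]

omit [NeZero L] in
/-- EL is preserved by `(x,y) ↦ (−x,y)`. [folklore] -/
theorem EL_comp_mirror {Δ lam : ℝ} {g : Tor L → ℝ} (hg : ∀ r : Tor L, r ≠ 0 → tmOp L Δ g r = lam * g r) :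
    ∀ r : Tor L, r ≠ 0 → tmOp L Δ (fun s => g (-s.1, s.2)) r = lam * g (-r.1, r.2) := by
  intro r hr
  rw [tmOp_comp_mirror, hg _ (mirror_ne_zero' L hr)]

/-! ## The minimum is attained on the sphere -/

/-- continuity of the two-magnon form. [folklore] -/
theorem continuous_twoMagnonQF (Δ : ℝ) : Continuous (twoMagnonQF L Δ) := by
  have e : twoMagnonQF L Δ = fun g => ∑ r : Tor L, ((4 - Δ * nnInd L r) * g r ^ 2 - g r * nbSum L g r) :=
    funext (twoMagnonQF_eq L Δ)
  rw [e]
  refine continuous_finsetSum _ fun r _ => ?_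
  unfold nbSum
  fun_prop

/-- the constrained sphere `{g(0) = 0, Σ g² = 1}` is compact. [folklore] -/
theorem isCompact_sphere0 :
    IsCompact {g : Tor L → ℝ | g 0 = 0 ∧ ∑ r : Tor L, g r ^ 2 = 1} := by
  apply Metric.isCompact_of_isClosed_isBounded
  · refine IsClosed.inter (isClosed_eq (continuous_apply 0) continuous_const) (isClosed_eq ?_ continuous_const)
    exact continuous_finsetSum _ fun r _ => (continuous_apply r).pow 2
  · refine (Metric.isBounded_closedBall (x := (0 : Tor L → ℝ)) (r := 1)).subset fun g hg => ?_
    obtain ⟨_, hg1⟩ := hg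
    rw [Metric.mem_closedBall, dist_zero_right, pi_norm_le_iff_of_nonneg zero_le_one]
    intro r
    have hle : g r ^ 2 ≤ ∑ s : Tor L, g s ^ 2 := Finset.single_le_sum (fun s _ => sq_nonneg (g s)) (Finset.mem_univ r)
    rw [hg1] at hle
    rw [Real.norm_eq_abs]
    nlinarith [abs_nonneg (g r), sq_abs (g r)]

/-- **the variational principle:** for `L ≥ 2` there are `λ` and `f₀` with `f₀(0) = 0`, `Σ f₀² = 1`, `Q(f₀) = λ`, and
`λ Σ g² ≤ Q(g)` for every `g` vanishing at the origin. [folklore] -/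
theorem exists_min_sphere (hL : 2 ≤ L) (Δ : ℝ) :
    ∃ lam : ℝ, ∃ f₀ : Tor L → ℝ, f₀ 0 = 0 ∧ (∑ r : Tor L, f₀ r ^ 2) = 1 ∧ twoMagnonQF L Δ f₀ = lam ∧
      ∀ g : Tor L → ℝ, g 0 = 0 → lam * ∑ r : Tor L, g r ^ 2 ≤ twoMagnonQF L Δ g := by
  classical
  set S : Set (Tor L → ℝ) := {g | g 0 = 0 ∧ ∑ r : Tor L, g r ^ 2 = 1} with hS
  have hK : K1 L ≠ 0 := K1_ne_zero L hL
  have hSne : S.Nonempty := by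
    refine ⟨fun r => if r = K1 L then 1 else 0, ?_, ?_⟩
    · simp [hK.symm]
    · simp [Finset.sum_ite_eq', apply_ite (· ^ 2)]
  obtain ⟨f₀, ⟨hf0, hf1⟩, hmin⟩ :=
    (isCompact_sphere0 L).exists_isMinOn hSne (continuous_twoMagnonQF L Δ).continuousOn
  refine ⟨twoMagnonQF L Δ f₀, f₀, hf0, hf1, rfl, fun g hg => ?_⟩
  have hN0 : 0 ≤ ∑ r : Tor L, g r ^ 2 := Finset.sum_nonneg fun r _ => sq_nonneg (g r)
  rcases hN0.lt_or_eq with hpos | h0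
  · set N : ℝ := ∑ r : Tor L, g r ^ 2 with hN
    set c : ℝ := (Real.sqrt N)⁻¹ with hc
    have hcc : c ^ 2 * N = 1 := by
      rw [hc, inv_pow, Real.sq_sqrt hpos.le, inv_mul_cancel₀ hpos.ne']
    have hmem : (fun r => c * g r) ∈ S := by
      refine ⟨by simp [hg], ?_⟩
      have : ∑ r : Tor L, (c * g r) ^ 2 = c ^ 2 * N := by
        rw [hN, Finset.mul_sum]; refine Finset.sum_congr rfl fun r _ => ?_; ring
      rw [this, hcc]
    have hq := hmin hmem
    rw [Set.mem_setOf_eq, qf_smul] at hq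
    calc twoMagnonQF L Δ f₀ * N ≤ c ^ 2 * twoMagnonQF L Δ g * N := mul_le_mul_of_nonneg_right hq hpos.le
      _ = twoMagnonQF L Δ g * (c ^ 2 * N) := by ring
      _ = twoMagnonQF L Δ g := by rw [hcc, mul_one]
  · -- Σ g² = 0: g = 0
    have hg0 : ∀ r, g r = 0 := fun r => by
      have := (Finset.sum_eq_zero_iff_of_nonneg (fun s (_ : s ∈ Finset.univ) => sq_nonneg (g s))).1 h0.symm r
        (Finset.mem_univ r)
      exact pow_eq_zero_iff (two_ne_zero) |>.mp this
    have hQ0 : twoMagnonQF L Δ g = 0 := by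
      rw [twoMagnonQF_eq]; simp [hg0, nbSum]
    rw [← h0, hQ0, mul_zero]

/-! ## Positivity of a nonnegative minimiser -/

/-- **a nonnegative constrained minimiser with `Σ g² = 1` is positive off the origin** (`L ≥ 2`). [folklore] -/
theorem pos_of_nonneg_min (hL : 2 ≤ L) {Δ lam : ℝ} {g : Tor L → ℝ} (hg0 : ∀ r, 0 ≤ g r)
    (hmin : ∀ h : Tor L → ℝ, h 0 = 0 → lam * ∑ r : Tor L, h r ^ 2 ≤ twoMagnonQF L Δ h)
    (hgQ : twoMagnonQF L Δ g = lam * ∑ r : Tor L, g r ^ 2) (hz : g 0 = 0) (h1 : ∑ r : Tor L, g r ^ 2 = 1)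
    (r : Tor L) (hr : r ≠ 0) : 0 < g r := by
  rcases (hg0 r).lt_or_eq with h | h
  · exact h
  · exfalso
    have hnb : ∀ s : Tor L, s ≠ 0 → g s = 0 → nbSum L g s = 0 :=
      fun s hs hgs => nbSum_eq_zero_of_min L hg0 hmin hgQ hz hs hgs
    have hx : ∀ s : Tor L, s ≠ 0 → g s = 0 → s + ex L ≠ 0 → g (s + ex L) = 0 := by
      intro s hs hgs _
      have h' := hnb s hs hgs
      unfold nbSum at h'
      have := hg0 (s + ex L); have := hg0 (s + -ex L); have := hg0 (s + ey L); have := hg0 (s + -ey L)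
      linarith
    have hy : ∀ s : Tor L, s ≠ 0 → g s = 0 → s + ey L ≠ 0 → g (s + ey L) = 0 := by
      intro s hs hgs _
      have h' := hnb s hs hgs
      unfold nbSum at h'
      have := hg0 (s + ex L); have := hg0 (s + -ex L); have := hg0 (s + ey L); have := hg0 (s + -ey L)
      linarith
    have hall : ∀ s : Tor L, g s = 0 := by
      intro s
      by_cases hs : s = 0
      · rw [hs, hz]
      · exact torus_connect L hL (fun u => g u = 0) hx hy hr hs h.symm
    have : ∑ s : Tor L, g s ^ 2 = 0 := by simp [hall]
    rw [h1] at this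
    exact one_ne_zero this

end Summit.HubbardSuperconductivity.HubbardSuperconductivity.Theorems.AnisotropyChord.Transfer.Fibre3

end
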